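import Summits.BirchSwinnertonDyer.BirchSwinnertonDyer.Theorems.PrintCFramBottomClassIndexLawFiveLeFlipRungLowerUnipotentVehicle
import Summits.BirchSwinnertonDyer.BirchSwinnertonDyer.Theorems.PrintCFramBottomClassIndexLawFiveLeFlipRungLowerUnipotentWeight
import Summits.BirchSwinnertonDyer.BirchSwinnertonDyer.Theorems.PrintCFramBottomClassIndexLawFiveLeFlipRungLowerUnipotentMoment
import Summits.BirchSwinnertonDyer.BirchSwinnertonDyer.Theorems.PrintCFramBottomClassIndexLawFiveLeFlipRungLowerSlash
import Summits.BirchSwinnertonDyer.BirchSwinnertonDyer.Theorems.PrintCFramBottomClassIndexLawFiveLeFlipRungModularVehicle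
import Summits.BirchSwinnertonDyer.BirchSwinnertonDyer.Theorems.PrintCFramBottomClassIndexLawFiveLeFlipRungOfJML
import HarnessLib

set_option autoImplicit false

/-!
# Crux `PrintCFram.BottomClassIndexLawFiveLe` (stmt-BirchSwinnertonDyer-20372), line `eisenstein-resource-bdp-line` (registry v29 → v30):
# «T8 — THE LOWER-UNIPOTENT RUNG», piece T8-7: THE MODULAR ASSEMBLY `jmlAll_six_of_socket : NF-A → (LowerSocket⁶) → (JMLall⁶)`
# (cell `bsd-print-cfram`, width seat `bsd-line-cfram-p1-w3` g19; THEOREMS ONLY, `--supports` 20372; BSD is not proved by any of this)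

HONEST FRAMING. Nothing here is a statement about elliptic curves or BSD; no registered stub is closed by this file alone. (JMLall⁶) is seat w8 g9's frozen
interface (HOME/STATUS 2026-08-29T09:14:36Z; the `hJML` binder of `FlipRung.rungAll_six_of_jmlAll`): for every class datum, sign pattern `τ`, odd prime `q ∣ m`,
`q ∤ v` and coefficient function `a` (Cohen numbers on the away-from-`q` cut, `0` off it) there are `N, D, Θ` such that «class `n ≡ qv (mod q²)` of
`a ⋆ Θ` in `p·ℤ̄[1/N]` ⟹ `‖(a ⋆ Θ)(n)‖_p ≤ p⁻¹` for EVERY `n` with `q ∥ n`» — BOTH Legendre classes, NO flip condition (Raum 2023 Prop. 2.3, kernel road).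
THE CHAIN (crux notes `Lines/eisenstein-resource-bdp-line-w3g19-notes.md` §2): the away period `Q₀ = 8c·(m/q)²` (`c ∈ {1,3}`; `p ∤ Q₀`, `q ∤ Q₀`;
w8 g9's `awayCut_add_iff`) → seat w4 g19's vehicle `exists_flipVehicle_of_periodic` (the cut of `H_k·θ((qQ₀)²·)` as a `Γ₁`-form, NF-A, with `hinv` for
`M = 4Q₀⁴`) → the single-class twist `V_β`, `β = qv` (`exists_classTwist_forall_coeff_mem`, memberships at `∞` from the class hypothesis) → for every
`t ≠ 0` in `ℤ/q`: the CRT integer `C ≡ t`, `M ∣ C`, the lower unipotent `γ_t = [1 0; q²C 1]`, seat w5 g8's PER-CUSP SOCKET (its decomposition (U1)(U2) +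
coefficient corollary + NF-Q = T4 §3, abstracted here as the hypothesis (LowerSocket⁶) = the universal closure of
`FlipRung.exists_isIntegral_lowerUnipotent_coeff`, instantiated in the sequel file once that lands) and seat w6 g9's moment
`lowerUnipotentMoment_cexp_mul_eq` (the weight `= ψ_{q²}(t⁻¹(qv+qu))·q·K_{−t̄}(u,v)`) → my reading `norm_ratCast_le_inv_of_kloosterman_memberships_twisted`
(trace trick + Raum's Lemma 2.4 over `ℤ`). CONDITIONAL on NF-A (hypothesis) and on (LowerSocket⁶) (hypothesis; = NF-Q through w5 g8's socket).
No new definitions, no named facts, no `sorry`. beyond-print theorem: NO. BSD is not proved by any of this.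

References: M. Raum, Forum Math. 35 (2023) 615–646, Prop. 2.3, Lemma 2.4 [Raum2023RamanujanTypeII]; [Cohen1975] Thm. 3.1; [Katz1973] §1.6 Cor. 1.6.2.
-/

-- summit-side namespace `Summit.BirchSwinnertonDyer.BirchSwinnertonDyer.…` (single-conjunct summit, D-0017 layout)
set_option linter.dupNamespace false

noncomputable section

namespace Summit.BirchSwinnertonDyer.BirchSwinnertonDyer.Theorems.PrintCFram.FlipRung

open UpperHalfPlane hiding I
open Filter Function Complex CongruenceSubgroup PowerSeries Finset
open scoped MatrixGroups ModularForm Topology Manifold Real NumberTheorySymbols Classical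
open Literature.NumberTheory.ModularForms Literature.NumberTheory.ModularForms.CohenEisenstein
open Literature.NumberTheory.EllipticCurves.ModularForms.HeckeTGamma1 (one_mem_strictPeriods_Gamma1)

/-! ## §1 The away period with its prime factors under control -/

/-- **The away period.** For the away-from-`q` cut predicate of (JML⁶)/(JMLall⁶) (`m_q = m/q > 0`, `q` an odd prime with `q ∤ m_q`) and any prime
`p ≥ 7` with `p ∤ m_q`, there is a period `Q₀ = m_q · 8c·m_q` (`c = 1` if `q = 3`, else `3`) with `q ∤ Q₀` AND `p ∤ Q₀` (w8 g9's `awayCut_add_iff`;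
`exists_period_awayCut_coprime` is the same without the `p`-clause). [folklore] -/
theorem exists_period_awayCut_coprime_two (m mq q : ℕ) (τ : ℕ → ℤ) (hmq : 0 < mq) (hq : q.Prime) (hq2 : q ≠ 2) (hqmq : ¬ q ∣ mq)
    {p : ℕ} (hp : p.Prime) (h7 : 7 ≤ p) (hpmq : ¬ p ∣ mq) :
    ∃ Q₀ : ℕ, 0 < Q₀ ∧ ¬ q ∣ Q₀ ∧ ¬ p ∣ Q₀ ∧
      Function.Periodic (fun n : ℕ =>
        mq ∣ n ∧ n / mq % 4 = 3 * q % 4 ∧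
          (∀ q' : ℕ, q'.Prime → q' ∣ mq → q' ≠ 2 →
            jacobiSym (-((n / mq : ℕ) : ℤ)) q' = τ q' * jacobiSym (q : ℤ) q') ∧
          (2 ∣ m → n / mq % 8 = 7 * q % 8) ∧ (q ≠ 3 → ¬ 3 ∣ n / mq)) Q₀ := by
  set c : ℕ := if q = 3 then 1 else 3 with hc
  have hc0 : 0 < c := by rw [hc]; split_ifs <;> norm_num
  have hqc : ¬ q ∣ c := by
    rw [hc]; split_ifs with h
    · exact fun hd ↦ hq.one_lt.ne' (Nat.dvd_one.mp hd)
    · intro hd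
      exact h ((Nat.prime_dvd_prime_iff_eq hq Nat.prime_three).mp hd)
  have hpc : ¬ p ∣ c := by
    rw [hc]; split_ifs
    · exact fun hd ↦ hp.one_lt.ne' (Nat.dvd_one.mp hd)
    · intro hd
      have := (Nat.prime_dvd_prime_iff_eq hp Nat.prime_three).mp hd
      omega
  have hq8 : ¬ q ∣ 8 := by
    intro hd
    have : q ∣ 2 ^ 3 := by norm_num; exact hd
    exact hq2 ((Nat.prime_dvd_prime_iff_eq hq Nat.prime_two).mp (hq.dvd_of_dvd_pow this))
  have hp8 : ¬ p ∣ 8 := by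
    intro hd
    have : p ∣ 2 ^ 3 := by norm_num; exact hd
    have := (Nat.prime_dvd_prime_iff_eq hp Nat.prime_two).mp (hp.dvd_of_dvd_pow this)
    omega
  refine ⟨mq * (8 * mq * c), by positivity, ?_, ?_, fun n ↦ ?_⟩
  · intro hd
    rcases (Nat.Prime.dvd_mul hq).mp hd with h | h
    · exact hqmq h
    · rcases (Nat.Prime.dvd_mul hq).mp h with h | h
      · rcases (Nat.Prime.dvd_mul hq).mp h with h | h
        · exact hq8 h
        · exact hqmq h
      · exact hqc h
  · intro hd
    rcases (Nat.Prime.dvd_mul hp).mp hd with h | h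
    · exact hpmq h
    · rcases (Nat.Prime.dvd_mul hp).mp h with h | h
      · rcases (Nat.Prime.dvd_mul hp).mp h with h | h
        · exact hp8 h
        · exact hpmq h
      · exact hpc h
  · have key := awayCut_add_iff m mq q τ (8 * mq * c) n 1 hmq ⟨mq * c, by ring⟩
      (fun q' _ hq'm ↦ dvd_mul_of_dvd_left (dvd_mul_of_dvd_right hq'm 8) c)
      (fun h3 ↦ ⟨8 * mq, by rw [hc, if_neg h3]; ring⟩)
    rw [mul_one] at key
    exact propext key

/-! ## §2 THE MODULAR ASSEMBLY of the lower-unipotent rung, from NF-A and the per-cusp socket -/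

/-- **T8-7: (JMLall⁶) FROM NF-A AND THE PER-CUSP SOCKET.** `hA` = Cohen 1975 Thm 3.1 (NF-A, cite-only); `hSock` = (LowerSocket⁶) := the universal
closure of seat w5 g8's `exists_isIntegral_lowerUnipotent_coeff` ((U1)(U2) decomposition at `γ = [1 0; q²C 1]`, the coefficient of `e((qu)z)`, and
Katz's principle NF-Q through T4 §3): «for the twisted form `V = q⁻² Σ_j h(j) F₀(· + j/q²)` of an `M`-`hinv` vehicle `F₀ = Σ c₀(n)e(nz)` with all
coefficients of `qExpansion 1 V` in `p·ℤ̄[1/N]`, and `M ∣ C`: `q⁻²·c₀(qu)·Σ_{q ∤ 1+jC} h(j) e(qu·h'_j/q²) ∈ p·ℤ̄[1/N]`». Conclusion = w8 g9's frozen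
(JMLall⁶) (09:14:36Z) VERBATIM. Witnesses: `N = 4(qQ₀)²Q₀²·q⁴`, `D = (qQ₀)²`, `Θ` = the coefficient series of `θ((qQ₀)²·)`.
[cite: Raum2023RamanujanTypeII, Prop. 2.3] [cite: Cohen1975, Thm. 3.1] [cite: Katz1973, §1.6 Cor. 1.6.2] -/
theorem jmlAll_six_of_socket
    (hA : Cohen1975.thm31_cohenSeries_mem_halfIntModularForms)
    (hSock : ∀ (q : ℕ) [NeZero (q ^ 2)], q ≠ 0 → ∀ (γ : SL(2, ℤ)) (M C : ℤ), M ∣ C →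
      γ 0 0 = 1 → γ 0 1 = 0 → γ 1 0 = (q : ℤ) ^ 2 * C → γ 1 1 = 1 →
      ∀ (k : ℤ) (L N : ℕ) [NeZero N], L ∣ N → 3 ≤ N → ∀ (V : ModularForm (Gamma1 L) k) (p : ℕ),
      (∀ n : ℕ, ∃ y : ℂ, (∃ j : ℕ, IsIntegral ℤ ((N : ℂ) ^ j * y)) ∧ (qExpansion 1 ⇑V).coeff n = (p : ℂ) * y) →
      ∀ (F₀ : ℍ → ℂ), (∀ γ' : SL(2, ℤ), M * (q : ℤ) ^ 2 ∣ γ' 1 0 → M ∣ γ' 1 1 - 1 → F₀ ∣[k] γ' = F₀) →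
      ∀ (c₀ : ℕ → ℂ), (∀ τ : ℍ, HasSum (fun n : ℕ ↦ c₀ n * Periodic.qParam 1 (τ : ℂ) ^ n) (F₀ τ)) →
      ∀ (h : ZMod (q ^ 2) → ℂ),
      (∀ z : ℍ, (⇑V : ℍ → ℂ) z = ((q : ℂ) ^ 2)⁻¹ * ∑ j : ZMod (q ^ 2), h j * F₀ (((j.val : ℝ) / (q : ℝ) ^ 2) +ᵥ z)) →
      ∀ (h' e : ZMod (q ^ 2) → ℤ),
      (∀ j : ZMod (q ^ 2), ¬ (q : ℤ) ∣ 1 + (j.val : ℤ) * C → (1 + (j.val : ℤ) * C) * h' j = (j.val : ℤ) + (q : ℤ) ^ 2 * e j) →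
      ∀ (u : ℕ), ¬ q ∣ u →
      ∃ y : ℂ, (∃ j : ℕ, IsIntegral ℤ ((N : ℂ) ^ j * y)) ∧
        ((q : ℂ) ^ 2)⁻¹ * c₀ (q * u) *
          (∑ j ∈ univ.filter (fun j : ZMod (q ^ 2) ↦ ¬ (q : ℤ) ∣ 1 + (j.val : ℤ) * C),
            h j * cexp (2 * π * I * ((h' j : ℂ) / (q : ℂ) ^ 2) * ((q * u : ℕ) : ℂ))) = (p : ℂ) * y) :
    ∀ (p : ℕ) [Fact p.Prime] (m : ℕ) [NeZero m] (χ : DirichletCharacter ℚ_[p] m) (k : ℕ),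
      (p = 7 ∨ p = 11 ∨ p = 19 ∨ p = 43 ∨ p = 67 ∨ p = 163) →
      m.Coprime p → χ.IsPrimitive → χ.IsQuadratic → (k = (p + 1) / 4 ∨ k = (3 * p - 1) / 4) →
      2 ≤ k → k ≤ p - 2 → χ (-1) * (-1) ^ k = -1 →
      ∀ (τ : ℕ → ℤ) (q : ℕ), q.Prime → q ∣ m → q ≠ 2 →
      (∀ q' : ℕ, q'.Prime → q' ∣ m → q' ≠ 2 → (τ q' = 1 ∨ τ q' = -1)) →
      ∀ (v : ℕ), ¬ q ∣ v →
      ∀ (a : ℕ → ℚ),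
        (∀ i : ℕ, (m / q ∣ i ∧ i / (m / q) % 4 = 3 * q % 4 ∧
            (∀ q' : ℕ, q'.Prime → q' ∣ m / q → q' ≠ 2 →
              jacobiSym (-((i / (m / q) : ℕ) : ℤ)) q' = τ q' * jacobiSym (q : ℤ) q') ∧
            (2 ∣ m → i / (m / q) % 8 = 7 * q % 8) ∧ (q ≠ 3 → ¬ 3 ∣ i / (m / q))) → a i = cohenH k i) →
        (∀ i : ℕ, ¬ (m / q ∣ i ∧ i / (m / q) % 4 = 3 * q % 4 ∧
            (∀ q' : ℕ, q'.Prime → q' ∣ m / q → q' ≠ 2 →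
              jacobiSym (-((i / (m / q) : ℕ) : ℤ)) q' = τ q' * jacobiSym (q : ℤ) q') ∧
            (2 ∣ m → i / (m / q) % 8 = 7 * q % 8) ∧ (q ≠ 3 → ¬ 3 ∣ i / (m / q))) → a i = 0) →
      ∃ (N D : ℕ) (Θ : PowerSeries ℕ),
        ¬ p ∣ N ∧ 2 ∣ N ∧ q ^ 2 ∣ D ∧
        Function.Periodic (fun i : ℕ => (m / q ∣ i ∧ i / (m / q) % 4 = 3 * q % 4 ∧
            (∀ q' : ℕ, q'.Prime → q' ∣ m / q → q' ≠ 2 →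
              jacobiSym (-((i / (m / q) : ℕ) : ℤ)) q' = τ q' * jacobiSym (q : ℤ) q') ∧
            (2 ∣ m → i / (m / q) % 8 = 7 * q % 8) ∧ (q ≠ 3 → ¬ 3 ∣ i / (m / q)))) D ∧
        PowerSeries.coeff 0 Θ = 1 ∧ (∀ j : ℕ, PowerSeries.coeff j Θ ≠ 0 → D ∣ j) ∧
        ((∀ n : ℕ, n % q ^ 2 = q * v % q ^ 2 →
            ∃ y : ℂ, (∃ j : ℕ, IsIntegral ℤ ((N : ℂ) ^ j * y)) ∧
              ((PowerSeries.coeff n (PowerSeries.mk a * PowerSeries.map (Nat.castRingHom ℚ) Θ) : ℚ) : ℂ) = (p : ℂ) * y) →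
          ∀ n : ℕ, q ∣ n → ¬ q ^ 2 ∣ n →
            ‖((PowerSeries.coeff n (PowerSeries.mk a * PowerSeries.map (Nat.castRingHom ℚ) Θ) : ℚ) : ℚ_[p])‖ ≤ (p : ℝ)⁻¹) := by
  intro p _ m _ χ k hp6 hmp hχ hχq hk h2k hkp hpar τ q hq hqm hq2 hτ v hv a ha1 ha0
  -- numerics of the datum
  have hpp : p.Prime := Fact.out
  have h7 : 7 ≤ p := by rcases hp6 with h | h | h | h | h | h <;> omega
  have hp2 : p ≠ 2 := by omega
  haveI : Fact q.Prime := ⟨hq⟩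
  haveI : NeZero (q ^ 2) := ⟨pow_ne_zero 2 hq.ne_zero⟩
  have hq0 : q ≠ 0 := hq.ne_zero
  have hm0 : 0 < m := Nat.pos_of_ne_zero (NeZero.ne m)
  have hqm2 : ¬ q ^ 2 ∣ m := not_sq_dvd_conductor_of_odd_prime hχ hχq hq hq2 hqm
  have hm : m = q * (m / q) := (Nat.mul_div_cancel' hqm).symm
  have hmq : 0 < m / q := Nat.div_pos (Nat.le_of_dvd hm0 hqm) hq.pos
  have hqmq : ¬ q ∣ m / q := fun ⟨c', hc'⟩ ↦ hqm2 ⟨c', by rw [hm, hc']; ring⟩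
  have hpq : p ≠ q := by
    rintro rfl
    have := Nat.Coprime.eq_one_of_dvd (Nat.Coprime.symm hmp) hqm
    exact hpp.one_lt.ne' this
  have hpm : ¬ p ∣ m := fun h ↦ hpp.one_lt.ne' (Nat.Coprime.eq_one_of_dvd (Nat.Coprime.symm hmp) h)
  have hpmq : ¬ p ∣ m / q := fun h ↦ hpm (h.trans (Nat.div_dvd_of_dvd hqm))
  -- the away period
  obtain ⟨Q₀, hQ₀pos, hqQ₀, hpQ₀, hperQ₀⟩ :=
    exists_period_awayCut_coprime_two m (m / q) q τ hmq hq hq2 hqmq hpp h7 hpmq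
  haveI : NeZero Q₀ := ⟨hQ₀pos.ne'⟩
  -- the vehicle (NF-A): the away cut of `H_k · θ((qQ₀)²·)`
  obtain ⟨g, Θ, b, hΘ0, hΘsupp, -, hgq, hinv⟩ := exists_flipVehicle_of_periodic hA h2k (q := q) (Q₀ := Q₀) hq.pos
    (fun i : ℕ => (m / q ∣ i ∧ i / (m / q) % 4 = 3 * q % 4 ∧
      (∀ q' : ℕ, q'.Prime → q' ∣ m / q → q' ≠ 2 → jacobiSym (-((i / (m / q) : ℕ) : ℤ)) q' = τ q' * jacobiSym (q : ℤ) q') ∧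
      (2 ∣ m → i / (m / q) % 8 = 7 * q % 8) ∧ (q ≠ 3 → ¬ 3 ∣ i / (m / q)))) hperQ₀
  -- identify the cut Cohen numbers with `a`
  have ha : (PowerSeries.mk fun i : ℕ ↦ if (m / q ∣ i ∧ i / (m / q) % 4 = 3 * q % 4 ∧
      (∀ q' : ℕ, q'.Prime → q' ∣ m / q → q' ≠ 2 → jacobiSym (-((i / (m / q) : ℕ) : ℤ)) q' = τ q' * jacobiSym (q : ℤ) q') ∧
      (2 ∣ m → i / (m / q) % 8 = 7 * q % 8) ∧ (q ≠ 3 → ¬ 3 ∣ i / (m / q))) then cohenH k i else 0) = PowerSeries.mk a := by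
    congr 1
    funext i
    split_ifs with hi
    · exact (ha1 i hi).symm
    · exact (ha0 i hi).symm
  have hc : ∀ n : ℕ, (qExpansion 1 ⇑g).coeff n =
      (((PowerSeries.coeff n (PowerSeries.mk a * PowerSeries.map (Nat.castRingHom ℚ) Θ)) : ℚ) : ℂ) := fun n ↦ by rw [hgq n, ha]
  -- the witnesses: `N = 4(qQ₀)²Q₀²·q⁴`, `D = (qQ₀)²`
  have hN3 : 3 ≤ 4 * (q * Q₀) ^ 2 * Q₀ ^ 2 * (q ^ 2) ^ 2 := by
    have : 1 ≤ (q * Q₀) ^ 2 * Q₀ ^ 2 * (q ^ 2) ^ 2 := Nat.one_le_iff_ne_zero.mpr (by positivity)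
    nlinarith
  haveI : NeZero (4 * (q * Q₀) ^ 2 * Q₀ ^ 2 * (q ^ 2) ^ 2) := ⟨by omega⟩
  have hpN : ¬ p ∣ 4 * (q * Q₀) ^ 2 * Q₀ ^ 2 * (q ^ 2) ^ 2 := by
    intro hd
    have hp4 : ¬ p ∣ 4 := by
      intro h4
      have : p ∣ 2 ^ 2 := by norm_num; exact h4
      exact hp2 ((Nat.prime_dvd_prime_iff_eq hpp Nat.prime_two).mp (hpp.dvd_of_dvd_pow this))
    have hpq' : ¬ p ∣ q := fun h ↦ hpq ((Nat.prime_dvd_prime_iff_eq hpp hq).mp h)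
    rcases (Nat.Prime.dvd_mul hpp).mp hd with h | h
    · rcases (Nat.Prime.dvd_mul hpp).mp h with h | h
      · rcases (Nat.Prime.dvd_mul hpp).mp h with h | h
        · exact hp4 h
        · rcases (Nat.Prime.dvd_mul hpp).mp (hpp.dvd_of_dvd_pow h) with h | h
          · exact hpq' h
          · exact hpQ₀ h
      · exact hpQ₀ (hpp.dvd_of_dvd_pow h)
    · exact hpq' (hpp.dvd_of_dvd_pow (hpp.dvd_of_dvd_pow h))
  have h2N : 2 ∣ 4 * (q * Q₀) ^ 2 * Q₀ ^ 2 * (q ^ 2) ^ 2 := ⟨2 * (q * Q₀) ^ 2 * Q₀ ^ 2 * (q ^ 2) ^ 2, by ring⟩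
  refine ⟨4 * (q * Q₀) ^ 2 * Q₀ ^ 2 * (q ^ 2) ^ 2, (q * Q₀) ^ 2, Θ, hpN, h2N, ⟨Q₀ ^ 2, by ring⟩, ?_, hΘ0, ?_, ?_⟩
  · have e : (q * Q₀) ^ 2 = (q ^ 2 * Q₀) * Q₀ := by ring
    rw [e]
    exact hperQ₀.nat_mul _
  · intro j hj
    obtain ⟨m', rfl⟩ := hΘsupp j hj
    exact ⟨m' ^ 2, rfl⟩
  -- THE IMPLICATION
  intro hcls n hqn hq2n
  obtain ⟨u, rfl⟩ := hqn
  have hu : ¬ q ∣ u := fun ⟨u', hu'⟩ ↦ hq2n ⟨u', by rw [hu']; ring⟩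
  -- the single-class twist `V_β`, `β = q·v`
  have hcl : ∀ n' : ℕ, (n' : ZMod (q ^ 2)) = ((q * v : ℕ) : ZMod (q ^ 2)) →
      ∃ y : ℂ, (∃ j : ℕ, IsIntegral ℤ (((4 * (q * Q₀) ^ 2 * Q₀ ^ 2 * (q ^ 2) ^ 2 : ℕ) : ℂ) ^ j * y)) ∧
      (((PowerSeries.coeff n' (PowerSeries.mk a * PowerSeries.map (Nat.castRingHom ℚ) Θ)) : ℚ) : ℂ) = (p : ℂ) * y := fun n' hn' ↦
    hcls n' ((ZMod.natCast_eq_natCast_iff' n' (q * v) (q ^ 2)).mp hn')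
  obtain ⟨V, hV, -, hVmem⟩ := exists_classTwist_forall_coeff_mem g q ((q * v : ℕ) : ZMod (q ^ 2)) (p := p)
    (N := 4 * (q * Q₀) ^ 2 * Q₀ ^ 2 * (q ^ 2) ^ 2) hc hcl
  -- the vehicle data for the socket
  have hF₀ : ∀ τ' : ℍ, HasSum (fun n' : ℕ ↦ (qExpansion 1 ⇑g).coeff n' * Periodic.qParam 1 (τ' : ℂ) ^ n') (g τ') := by
    intro τ'
    have h := UpperHalfPlane.hasSum_qExpansion one_pos
      (SlashInvariantFormClass.periodic_comp_ofComplex g (one_mem_strictPeriods_Gamma1 _)) (ModularFormClass.holo g)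
      (ModularFormClass.bdd_at_infty g) τ'
    simpa only [smul_eq_mul] using h
  -- the modulus `M = 4Q₀⁴` is prime to `q`; CRT data `C_t`
  have hMq : (4 * Q₀ ^ 4).Coprime (q ^ 2) := by
    apply Nat.Coprime.pow_right
    rw [Nat.coprime_comm, Nat.Prime.coprime_iff_not_dvd hq]
    intro hd
    rcases (Nat.Prime.dvd_mul hq).mp hd with h | h
    · have : q ∣ 2 ^ 2 := by norm_num; exact h
      exact hq2 ((Nat.prime_dvd_prime_iff_eq hq Nat.prime_two).mp (hq.dvd_of_dvd_pow this))
    · exact hqQ₀ (hq.dvd_of_dvd_pow h)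
  choose Cf hCf hMCf using fun t : ZMod q ↦ exists_int_cast_eq_and_dvd hMq ((t.val : ℕ) : ZMod (q ^ 2))
  have hCfq : ∀ t : ZMod q, ((Cf t : ℤ) : ZMod q) = t := by
    intro t
    have h1 := congrArg (ZMod.castHom (dvd_pow_self q two_ne_zero) (ZMod q)) (hCf t)
    rw [map_intCast, map_natCast, ZMod.natCast_zmod_val] at h1
    exact h1
  have hCfunit : ∀ t : ZMod q, t ≠ 0 → IsUnit ((Cf t : ℤ) : ZMod (q ^ 2)) := by
    intro t ht
    rw [isUnit_intCast_iff_not_dvd q]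
    intro hd
    apply ht
    rw [← hCfq t, (ZMod.intCast_zmod_eq_zero_iff_dvd _ q).mpr hd]
  -- the units `t̃ ∈ (ℤ/q²)ˣ` and the phases
  set tU : ZMod q → (ZMod (q ^ 2))ˣ := fun t ↦ if h : IsUnit ((Cf t : ℤ) : ZMod (q ^ 2)) then h.unit else 1 with htUdef
  have htU : ∀ t : ZMod q, t ≠ 0 → ((tU t : (ZMod (q ^ 2))ˣ) : ZMod (q ^ 2)) = ((Cf t : ℤ) : ZMod (q ^ 2)) := by
    intro t ht
    simp only [htUdef, dif_pos (hCfunit t ht), IsUnit.unit_spec]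
  have hvq : ((v : ℤ) : ZMod q) ≠ 0 := by
    rw [Ne, ZMod.intCast_zmod_eq_zero_iff_dvd]
    exact_mod_cast hv
  have hqC : (q : ℂ) ≠ 0 := by exact_mod_cast hq0
  -- THE READING over all cusps `γ_t`
  refine norm_ratCast_le_inv_of_kloosterman_memberships_twisted (q := q) (N := 4 * (q * Q₀) ^ 2 * Q₀ ^ 2 * (q ^ 2) ^ 2)
    hp2 hpN (u : ZMod q) ((v : ℤ) : ZMod q) hvq
    (x := PowerSeries.coeff (q * u) (PowerSeries.mk a * PowerSeries.map (Nat.castRingHom ℚ) Θ))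
    (w := ((q : ℂ) ^ 2)⁻¹ * (q : ℂ)) (w' := (q : ℂ)) (by field_simp) (exists_isIntegral_pow_mul_natCast q)
    (M := q ^ 2)
    (fun t : ZMod q ↦ (((tU t)⁻¹ : (ZMod (q ^ 2))ˣ) : ZMod (q ^ 2)) *
      ((q : ZMod (q ^ 2)) * ((v : ℤ) : ZMod (q ^ 2)) + (q : ZMod (q ^ 2)) * (u : ZMod (q ^ 2))))
    fun t ht ↦ ?_
  -- per cusp: CRT integer, lower unipotent, good-translate solutions, the socket, the moment
  obtain ⟨γ, h00, h01, h10, h11⟩ := exists_lowerUnipotent q (Cf t)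
  obtain ⟨h', e, hhe⟩ := exists_goodTranslate_solutions hq (Cf t)
  have hMC : (4 * (Q₀ : ℤ) ^ 4) ∣ Cf t := by have := hMCf t; push_cast at this; exact this
  obtain ⟨y, hy, hsock⟩ := hSock q hq0 γ (4 * (Q₀ : ℤ) ^ 4) (Cf t) hMC h00 h01 h10 h11 ((k + 1 : ℕ) : ℤ)
    (4 * (q * Q₀) ^ 2 * Q₀ ^ 2 * (q ^ 2) ^ 2) (4 * (q * Q₀) ^ 2 * Q₀ ^ 2 * (q ^ 2) ^ 2) dvd_rfl hN3
    V p hVmem ⇑g hinv (fun n' ↦ (qExpansion 1 ⇑g).coeff n') hF₀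
    (fun j ↦ (ZMod.stdAddChar (-(j * ((q * v : ℕ) : ZMod (q ^ 2)))) : ℂ)) hV h' e hhe u hu
  -- the moment (w6 g9): the weight is `ψ_{q²}(t⁻¹(qv+qu)) · q · K_{−t̄}(u,v)`
  have hmom := lowerUnipotentMoment_cexp_mul_eq q (Cf t) (tU t) (htU t ht) (v : ℤ) h' e hhe u
  have hfilter : (∑ j ∈ univ.filter (fun j : ZMod (q ^ 2) ↦ ¬ (q : ℤ) ∣ 1 + (j.val : ℤ) * Cf t),
      (ZMod.stdAddChar (-(j * ((q * v : ℕ) : ZMod (q ^ 2)))) : ℂ) * cexp (2 * π * I * ((h' j : ℂ) / (q : ℂ) ^ 2) * ((q * u : ℕ) : ℂ))) =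
      ∑ j : ZMod (q ^ 2), (if (q : ℤ) ∣ 1 + (j.val : ℤ) * Cf t then (0 : ℂ) else
        ZMod.stdAddChar (-((((q : ℤ) * v : ℤ)) : ZMod (q ^ 2)) * j) *
          cexp (2 * π * I * ((h' j : ℂ) / (q : ℂ) ^ 2) * ((q * u : ℕ) : ℂ))) := by
    rw [sum_filter]
    refine sum_congr rfl fun j _ ↦ ?_
    have hβ' : -(j * ((q * v : ℕ) : ZMod (q ^ 2))) = -((((q : ℤ) * v : ℤ)) : ZMod (q ^ 2)) * j := by push_cast; ring
    rw [hβ']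
    split_ifs <;> rfl
  rw [hfilter, hmom, castHom_units_inv] at hsock
  have hcast : ZMod.castHom (dvd_pow_self q two_ne_zero) (ZMod q) ((tU t : (ZMod (q ^ 2))ˣ) : ZMod (q ^ 2)) = t := by
    rw [htU t ht, map_intCast, hCfq t]
  rw [hcast] at hsock
  refine ⟨y, hy, ?_⟩
  rw [← hsock, hc (q * u)]
  ring

end Summit.BirchSwinnertonDyer.BirchSwinnertonDyer.Theorems.PrintCFram.FlipRung

end
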